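import Summits.BirchSwinnertonDyer.BirchSwinnertonDyer.Theorems.PrintCFramBottomClassIndexLawFiveLeHerbrandUntwistHom
import Summits.BirchSwinnertonDyer.BirchSwinnertonDyer.Theorems.PrintCFramBottomClassIndexLawFiveLeHerbrandUntwistBadSetErased
import HarnessLib

/-!
# Route `PrintCFram`, crux C2 `BottomClassIndexLawFiveLe` (stmt-BirchSwinnertonDyer-20372), line `eisenstein-resource-bdp-line`
# (registry v11), Stub H′ `stub_homVanishing_of_bernoulliPair`: the HOM FORM with the bad set ERASED — Stub H (Selmer form, at the bad set
# `S`) ⟸ the Hom-vanishing statements whose cocycles are UNRAMIFIED AT EVERY `v ∤ p` (no exclusion of `S`)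

Cell `bsd-print-cfram`, width seat `bsd-line-cfram-p1-w7` (g0); helper `--supports stmt-BirchSwinnertonDyer-20372`; composition BY NAME of
LEAD g8's `HerbrandUntwist.stubH_of_forall_hom_of_cmRamified` (p651343, the theorem the v11 composition calls on Stub H′) at `S := ∅`
with this seat's S-erasure `UntwistBadSetErased.datumStrictSelmer_layerZero_eq_empty_of_subset_badSet` (p651697 ← p650489). THEOREMS ONLY
(0 definitions, 0 named facts, 0 instances, no `sorry`). HONEST FRAMING: nothing about BSD is proved; no stub is closed; BSD is not
proved by any of this; no summit statement is proved by this seat.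

## What, and the v12 TURNKEY it enables

v11's Stub H′ asks, for every `Γ_K`-invariant cocycle `z` on `N = ker(Γ_K → Aut Φ.Sub)` (resp. `Φ.Quot`) that vanishes on
`inertiaIn N v` for the `v ∤ p` OUTSIDE the bad set `S = {v : ¬ W_K good at v ∧ v ∤ p}` and on `decompIn N 𝔭`, that `z = 0`.
Since `S` is invisible to the residual Selmer groups (p650489), the stub may demand LESS: only cocycles vanishing on `inertiaIn N v` for
EVERY `v ∤ p` need to be killed — the class-field-theory / Kummer modulus is then supported on `{w ∣ 𝔭̄}` alone.

* **`stubH_of_forall_hom_everywhere_of_cmRamified`** — `W` CM, `CMRamified W p`, `5 ≤ p`, `K` quadratic, `κ`, `𝔭 ∋ p`, `Φ` stable of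
  order `p`, and ANY `S ⊆ {v : ¬ W_K good at v ∧ v ∤ p}`: IF every invariant cocycle on `N_S` (resp. `N_Q`) vanishing on `inertiaIn _ v` for
  ALL `v ∤ p` and on `decompIn _ 𝔭` is zero, THEN `datumStrictSelmer (κ.layerSubgroup 0) Φ.Sub p (bdpData Φ.Sub p 𝔭) S = ⊥` and the same
  for `Φ.Quot`.
* v12 TURNKEY (LEAD): in `stub_homVanishing_of_bernoulliPair` delete the two lines `v ∉ {v | ¬ … ∧ …} →`; in `BottomClassIndexLawFiveLe_of`
  replace the call of `HerbrandUntwist.stubH_of_forall_hom_of_cmRamified W hCM hram h5 K hK.1 κ 𝔭 h𝔭 {…} Φ hSub hhS hhQ` by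
  `UntwistHomBadSetErased.stubH_of_forall_hom_everywhere_of_cmRamified W hCM hram h5 hK.1 κ 𝔭 h𝔭 subset_rfl Φ hSub hhS hhQ`.

References: [GreenbergVatsal2000] §2 pp. 15–17, 20, 23, 28; [GreenbergLNM1716] §3; [SerreGaloisCohomology1997] I §2.6 (b), I §5.8.
-/

set_option autoImplicit false
-- the summit namespace `Summit.BirchSwinnertonDyer.BirchSwinnertonDyer` repeats the problem name by design (D-0017)
set_option linter.dupNamespace false

noncomputable section

open scoped Classical

namespace Summit.BirchSwinnertonDyer.BirchSwinnertonDyer.Theorems.PrintCFram.UntwistHomBadSetErased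

open NumberField Field IsDedekindDomain
  Literature.NumberTheory.EllipticCurves Literature.NumberTheory.EllipticCurves.GreenbergSelmer
  Literature.NumberTheory.EllipticCurves.GreenbergVatsal2000
  Literature.NumberTheory.EllipticCurves.Rank1Residual
  Literature.NumberTheory.GaloisRepresentations
  Summit.BirchSwinnertonDyer.Rank1Residual

variable {K : Type} [Field K] [NumberField K] {p : ℕ} [Fact p.Prime]

-- the two Hom-form hypotheses are large dependent types (as in the v11 composition, which uses 1000000 heartbeats)
set_option maxHeartbeats 800000 in
/-- **Stub H (Selmer form, at any `S` inside the bad set) ⟸ the Hom-vanishing statements for cocycles UNRAMIFIED AT EVERY `v ∤ p`.**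
For `W/ℚ` elliptic with CM, `p ≥ 5` CM-ramified, `K` quadratic, any `ℤ_p`-extension `κ`, any `𝔭 ∋ p`, any
`S ⊆ {v : ¬ W_K good at v ∧ v ∤ p}`, and a `Γ_K`-stable `Φ ≤ W_K[p]` of order `p` with `N_S = ker(Γ_K → Aut Φ.Sub)`,
`N_Q = ker(Γ_K → Aut(W_K[p]/Φ))`: if every `Γ_K`-invariant continuous cocycle `z` on `N_S` with values in `Φ.Sub` that vanishes on
`inertiaIn N_S v` for EVERY `v ∤ p` and on `decompIn N_S 𝔭` is identically zero, and likewise for `N_Q`, `Φ.Quot`, then both bottom-layer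
residual Selmer groups of Stub H vanish at `S` (LEAD g8's `HerbrandUntwist.stubH_of_forall_hom_of_cmRamified` at `S := ∅`, then the
S-erasure `UntwistBadSetErased.datumStrictSelmer_layerZero_eq_empty_of_subset_badSet`).
[cite: GreenbergLNM1716, §3 (PDF p. 86)] [cite: SerreGaloisCohomology1997, I.§2.6 (b)] [cite: GreenbergVatsal2000, §2 pp. 20, 28] -/
theorem stubH_of_forall_hom_everywhere_of_cmRamified (W : WeierstrassCurve ℚ) [W.IsElliptic] (hCM : W.HasCM)
    (hram : CMRamified W p) (h5 : 5 ≤ p) (hK2 : Module.finrank ℚ K = 2)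
    (κ : ZpExtension K p) (𝔭 : HeightOneSpectrum (𝓞 K)) (h𝔭 : ((p : ℕ) : 𝓞 K) ∈ 𝔭.asIdeal)
    {S : Set (HeightOneSpectrum (𝓞 K))}
    (hSbad : S ⊆ {v : HeightOneSpectrum (𝓞 K) | ¬ (W.baseChange K).HasGoodReductionAt v ∧ ((p : ℕ) : 𝓞 K) ∉ v.asIdeal})
    (Φ : X2.ResidualDevissageModules.StableSubgroup (absoluteGaloisGroup K) ((W.baseChange K).geomTorsion (p : ℤ)))
    (hcard : Nat.card Φ.Sub = p)
    (hS : ∀ z : contOneCocycles (discreteTopRep (MulAction.toPermHom (absoluteGaloisGroup K) Φ.Sub).ker Φ.Sub),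
      (∀ (g : absoluteGaloisGroup K) (n : (MulAction.toPermHom (absoluteGaloisGroup K) Φ.Sub).ker),
        g • z.1 (subgroupConj _ g n) = z.1 n) →
      (∀ v : HeightOneSpectrum (𝓞 K), ((p : ℕ) : 𝓞 K) ∉ v.asIdeal →
        ∀ x : inertiaIn (MulAction.toPermHom (absoluteGaloisGroup K) Φ.Sub).ker v, z.1 (inertiaInToH _ v x) = 0) →
      (∀ x : decompIn (MulAction.toPermHom (absoluteGaloisGroup K) Φ.Sub).ker 𝔭, z.1 (decompInToH _ 𝔭 x) = 0) →
      ∀ n, z.1 n = 0)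
    (hQ : ∀ z : contOneCocycles (discreteTopRep (MulAction.toPermHom (absoluteGaloisGroup K) Φ.Quot).ker Φ.Quot),
      (∀ (g : absoluteGaloisGroup K) (n : (MulAction.toPermHom (absoluteGaloisGroup K) Φ.Quot).ker),
        g • z.1 (subgroupConj _ g n) = z.1 n) →
      (∀ v : HeightOneSpectrum (𝓞 K), ((p : ℕ) : 𝓞 K) ∉ v.asIdeal →
        ∀ x : inertiaIn (MulAction.toPermHom (absoluteGaloisGroup K) Φ.Quot).ker v, z.1 (inertiaInToH _ v x) = 0) →
      (∀ x : decompIn (MulAction.toPermHom (absoluteGaloisGroup K) Φ.Quot).ker 𝔭, z.1 (decompInToH _ 𝔭 x) = 0) →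
      ∀ n, z.1 n = 0) :
    datumStrictSelmer (κ.layerSubgroup 0) Φ.Sub p (X11b.AcSelmer.bdpData Φ.Sub p 𝔭) S = ⊥ ∧
      datumStrictSelmer (κ.layerSubgroup 0) Φ.Quot p (X11b.AcSelmer.bdpData Φ.Quot p 𝔭) S = ⊥ := by
  -- the S-free hypotheses imply LEAD g8's hypotheses at `S := ∅`
  have hS' : ∀ z : contOneCocycles (discreteTopRep (MulAction.toPermHom (absoluteGaloisGroup K) Φ.Sub).ker Φ.Sub),
      (∀ (g : absoluteGaloisGroup K) (n : (MulAction.toPermHom (absoluteGaloisGroup K) Φ.Sub).ker),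
        g • z.1 (subgroupConj _ g n) = z.1 n) →
      (∀ v : HeightOneSpectrum (𝓞 K), v ∉ (∅ : Set (HeightOneSpectrum (𝓞 K))) → ((p : ℕ) : 𝓞 K) ∉ v.asIdeal →
        ∀ x : inertiaIn (MulAction.toPermHom (absoluteGaloisGroup K) Φ.Sub).ker v, z.1 (inertiaInToH _ v x) = 0) →
      (∀ x : decompIn (MulAction.toPermHom (absoluteGaloisGroup K) Φ.Sub).ker 𝔭, z.1 (decompInToH _ 𝔭 x) = 0) →
      ∀ n, z.1 n = 0 :=
    fun z hz hU hD ↦ hS z hz (fun v hpv x ↦ hU v (Set.notMem_empty v) hpv x) hD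
  have hQ' : ∀ z : contOneCocycles (discreteTopRep (MulAction.toPermHom (absoluteGaloisGroup K) Φ.Quot).ker Φ.Quot),
      (∀ (g : absoluteGaloisGroup K) (n : (MulAction.toPermHom (absoluteGaloisGroup K) Φ.Quot).ker),
        g • z.1 (subgroupConj _ g n) = z.1 n) →
      (∀ v : HeightOneSpectrum (𝓞 K), v ∉ (∅ : Set (HeightOneSpectrum (𝓞 K))) → ((p : ℕ) : 𝓞 K) ∉ v.asIdeal →
        ∀ x : inertiaIn (MulAction.toPermHom (absoluteGaloisGroup K) Φ.Quot).ker v, z.1 (inertiaInToH _ v x) = 0) →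
      (∀ x : decompIn (MulAction.toPermHom (absoluteGaloisGroup K) Φ.Quot).ker 𝔭, z.1 (decompInToH _ 𝔭 x) = 0) →
      ∀ n, z.1 n = 0 :=
    fun z hz hU hD ↦ hQ z hz (fun v hpv x ↦ hU v (Set.notMem_empty v) hpv x) hD
  obtain ⟨h1, h2⟩ := HerbrandUntwist.stubH_of_forall_hom_of_cmRamified W hCM hram h5 K hK2 κ 𝔭 h𝔭 ∅ Φ hcard hS' hQ'
  obtain ⟨e1, e2⟩ := UntwistBadSetErased.datumStrictSelmer_layerZero_eq_empty_of_subset_badSet W hCM hram h5 κ Φ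
    (X11b.AcSelmer.bdpData Φ.Sub p 𝔭) (X11b.AcSelmer.bdpData Φ.Quot p 𝔭) hSbad
  exact ⟨e1.trans h1, e2.trans h2⟩

set_option maxHeartbeats 800000 in
/-- **The same at Stub H's own bad set** (`S = {v : ¬ W_K good at v ∧ v ∤ p}` verbatim, `subset_rfl`) — the drop-in replacement for the
v11 composition's call. [cite: GreenbergLNM1716, §3 (PDF p. 86)] [cite: GreenbergVatsal2000, §2 pp. 20, 28] -/
theorem stubH_badSet_of_forall_hom_everywhere_of_cmRamified (W : WeierstrassCurve ℚ) [W.IsElliptic] (hCM : W.HasCM)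
    (hram : CMRamified W p) (h5 : 5 ≤ p) (hK2 : Module.finrank ℚ K = 2)
    (κ : ZpExtension K p) (𝔭 : HeightOneSpectrum (𝓞 K)) (h𝔭 : ((p : ℕ) : 𝓞 K) ∈ 𝔭.asIdeal)
    (Φ : X2.ResidualDevissageModules.StableSubgroup (absoluteGaloisGroup K) ((W.baseChange K).geomTorsion (p : ℤ)))
    (hcard : Nat.card Φ.Sub = p)
    (hS : ∀ z : contOneCocycles (discreteTopRep (MulAction.toPermHom (absoluteGaloisGroup K) Φ.Sub).ker Φ.Sub),
      (∀ (g : absoluteGaloisGroup K) (n : (MulAction.toPermHom (absoluteGaloisGroup K) Φ.Sub).ker),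
        g • z.1 (subgroupConj _ g n) = z.1 n) →
      (∀ v : HeightOneSpectrum (𝓞 K), ((p : ℕ) : 𝓞 K) ∉ v.asIdeal →
        ∀ x : inertiaIn (MulAction.toPermHom (absoluteGaloisGroup K) Φ.Sub).ker v, z.1 (inertiaInToH _ v x) = 0) →
      (∀ x : decompIn (MulAction.toPermHom (absoluteGaloisGroup K) Φ.Sub).ker 𝔭, z.1 (decompInToH _ 𝔭 x) = 0) →
      ∀ n, z.1 n = 0)
    (hQ : ∀ z : contOneCocycles (discreteTopRep (MulAction.toPermHom (absoluteGaloisGroup K) Φ.Quot).ker Φ.Quot),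
      (∀ (g : absoluteGaloisGroup K) (n : (MulAction.toPermHom (absoluteGaloisGroup K) Φ.Quot).ker),
        g • z.1 (subgroupConj _ g n) = z.1 n) →
      (∀ v : HeightOneSpectrum (𝓞 K), ((p : ℕ) : 𝓞 K) ∉ v.asIdeal →
        ∀ x : inertiaIn (MulAction.toPermHom (absoluteGaloisGroup K) Φ.Quot).ker v, z.1 (inertiaInToH _ v x) = 0) →
      (∀ x : decompIn (MulAction.toPermHom (absoluteGaloisGroup K) Φ.Quot).ker 𝔭, z.1 (decompInToH _ 𝔭 x) = 0) →
      ∀ n, z.1 n = 0) :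
    datumStrictSelmer (κ.layerSubgroup 0) Φ.Sub p (X11b.AcSelmer.bdpData Φ.Sub p 𝔭)
        {v : HeightOneSpectrum (𝓞 K) | ¬ (W.baseChange K).HasGoodReductionAt v ∧ ((p : ℕ) : 𝓞 K) ∉ v.asIdeal} = ⊥ ∧
      datumStrictSelmer (κ.layerSubgroup 0) Φ.Quot p (X11b.AcSelmer.bdpData Φ.Quot p 𝔭)
        {v : HeightOneSpectrum (𝓞 K) | ¬ (W.baseChange K).HasGoodReductionAt v ∧ ((p : ℕ) : 𝓞 K) ∉ v.asIdeal} = ⊥ :=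
  stubH_of_forall_hom_everywhere_of_cmRamified W hCM hram h5 hK2 κ 𝔭 h𝔭 subset_rfl Φ hcard hS hQ

end Summit.BirchSwinnertonDyer.BirchSwinnertonDyer.Theorems.PrintCFram.UntwistHomBadSetErased

end
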